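import Literature.NumberTheory.ComplexMultiplication.MultiFieldWeilOrbitCounting
import Mathlib.FieldTheory.Normal.Closure
import HarnessLib

/-!
# MULTI-FIELD WEIL ENGINE — THE GALOIS ∕ DEGREE FORMS OF THE HYPOTHESES `hH`, `hJ`, `h2T`: the three `Aut(ℂ)`-phrased binders of the engine's
# headlines produced VERBATIM from number-field data

Cell `pub-hodgecm2` (COR-CM), seat b30 gen 31 (2026-08-24); count-neutral own lane MULTI-FIELD WEIL ENGINE (stem `MultiFieldWeil*`), sequel of
`CorCM/MultiFieldWeilOrbitCounting.lean`.  Theorems only; no definition, no named fact, no `sorry`.  Nothing Hodge-theoretic is asserted here; `HC_CM` is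
NOT proved.  Setting of the engine: `k = Kf i₀` with a fixed complex embedding `τ`, fields `K_m = Kf (is m)` (`m : Fin r`) with `im m : k → K_m`.

* §1 **`exists_over_fix_move_of_apply_not_mem`** ⟹ the binder `hH` of `MultiFieldWeilEqualPrimes` ∕ `MultiFieldWeilMarkmanTowers` (an automorphism of
  `ℂ` over `τ(k)` FIXING every `τ`-embedding of the fields `K_m`, `P m`, and MOVING a `τ`-embedding of `K_{m₀}`) from: some `τ`-embedding `s` of `K_{m₀}`
  takes a value outside the compositum `L_P = L(k) · ∏_{P m} L(K_m)` of the Galois closures `L(K) = normalClosure ℚ K ℂ` (the fixed field of `Aut(ℂ/L_P)`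
  is `L_P`).  For CM fields `L(K_m)` is the compositum of the `τ`-embeddings' images, so nothing is lost.
* §2 **`jointTransitive_of_finrank`** ⟹ the binder `hJ` of `MultiFieldWeilJointPrimesHodge` (joint transitivity of `Aut(ℂ)` on the families of
  `τ`-embeddings of the fields `K_m`, `P m`) from: ONE family `s₀` of `τ`-embeddings whose images generate, with `τ(k)`, a subfield of `ℂ` of degree
  `[k : ℚ] · ∏_{P m} n_m` (`n_m = [K_m : k]` = the number of `τ`-embeddings) — linear disjointness of ONE compositum (orbit counting,
  `exists_ringEquiv_fix_comp_eq_comp_of_finrank`).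
* §3 **`twoTransitive_of_finrank`** ⟹ the binder `h2T` of `MultiFieldWeilTwoTransitiveTower` ∕ `…Coprime` ∕ `MultiFieldWeilMixedTower` (relative
  `2`-transitivity on the `τ`-embeddings of `K_{m₀}` by automorphisms fixing the `τ`-embeddings of the fields `K_m`, `P m`) from: ONE pair `s ≠ t` of
  `τ`-embeddings of `K_{m₀}` with `[L_P · s(K_{m₀}) · t(K_{m₀}) : L_P] = n_{m₀} (n_{m₀} − 1)` (`exists_ringEquiv_fix_pair_of_finrank`).

The headline variants with these hypotheses are in `CorCM/MultiFieldWeilGaloisHeadlines.lean`.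
[cite: Lang2002, VI §1 Thm. 1.1, Cor. 1.6 and V §2 Thm. 2.8] [cite: Shimura1998, §18.2 Lemma (i)] [cite: DixonMortimer1996, §1.6]

## References
* [Lang2002] S. Lang, *Algebra*, 3rd ed., GTM 211, V §2 Thm. 2.8, VI §1 Thm. 1.1 and Cor. 1.6.  [Shimura1998] G. Shimura, *Abelian varieties with complex
  multiplication and modular functions*, §18.2 Lemma (i).  [DixonMortimer1996] J. D. Dixon, B. Mortimer, *Permutation Groups*, GTM 163, §1.6.

Provenance: Literature home (namespace `Literature.NumberTheory.ComplexMultiplication.MultiFieldWeil`) of the Summits-side `CorCM/MultiFieldWeilGaloisHypotheses` (cell `pub-hodgecm2`, COR-CM; all its imports are `Literature/`, Mathlib and the already re-homed `MultiFieldWeilOrbitCounting`), which `Literature/` may not import; theorems only, no named fact, no definition. Nothing here bears on `HC_CM`. Lane `lit-hodgefound` (Layer A3: CM types, their Kubota ranks and Galois combinatorics), seat p20.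
-/

noncomputable section

open IntermediateField NumberField

namespace Literature.NumberTheory.ComplexMultiplication.MultiFieldWeil

open scoped Classical

/-! ## §0 A bookkeeping fact on subfields of `ℂ` -/

section Basic

variable {K : Type} [Field K] [NumberField K]

/-- The values of a complex embedding of a number field lie in its Galois closure `normalClosure ℚ K ℂ`. [cite: Lang2002, VI §1 Thm. 1.1, Cor. 1.6 and V §2 Thm. 2.8] -/
theorem ringHom_apply_mem_normalClosure (u : K →+* ℂ) (y : K) : u y ∈ normalClosure ℚ K ℂ :=
  u.toRatAlgHom.fieldRange_le_normalClosure ⟨y, rfl⟩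

end Basic

section Engine

variable {I : Type} {r : ℕ} {Kf : I → Type} [∀ i, Field (Kf i)] [∀ i, NumberField (Kf i)] {i₀ : I} {is : Fin r → I} {τ : Kf i₀ →+* ℂ}

/-! ## §1 `hH` from a value outside the compositum of the Galois closures -/

/-- **THE BINDER `hH` FROM GALOIS CLOSURES.**  If some `τ`-embedding `s` of `K_{m₀}` takes a value outside the compositum
`L(k) ⊔ ⨆_{P m} L(K_m)` of the Galois closures in `ℂ` (`L(K) = normalClosure ℚ K ℂ`), then some automorphism `ρ` of `ℂ` is the identity on `τ(k)`, FIXES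
every `τ`-embedding of every `K_m` with `P m`, and MOVES a `τ`-embedding of `K_{m₀}` — the shape of the hypothesis `hH` of
`hodgeConjectureFor_biproduct_comp_of_orderedPrimeTower_oneMember` ∕ `…_of_sexticDecicTower` (take `P m ≡ (n m = n m₀ ∧ prio m < prio m₀)`) and
`…_of_sexticTower` ∕ `…_of_decicTower` (`P m ≡ m < m₀`). [cite: Lang2002, VI §1 Thm. 1.1, Cor. 1.6 and V §2 Thm. 2.8] [cite: Shimura1998, §18.2 Lemma (i)] -/
theorem exists_over_fix_move_of_apply_not_mem (im : ∀ m : Fin r, Kf i₀ →+* Kf (is m)) (P : Fin r → Prop) (m₀ : Fin r)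
    (s : Kf (is m₀) →+* ℂ) (hs : s.comp (im m₀) = τ) (a : Kf (is m₀))
    (ha : s a ∉ normalClosure ℚ (Kf i₀) ℂ ⊔ ⨆ m : {m : Fin r // P m}, normalClosure ℚ (Kf (is m.1)) ℂ) :
    ∃ ρ : ℂ ≃+* ℂ, (ρ : ℂ →+* ℂ).comp τ = τ ∧
      (∀ m, P m → ∀ u : Kf (is m) →+* ℂ, u.comp (im m) = τ → (ρ : ℂ →+* ℂ).comp u = u) ∧
      ∃ s : Kf (is m₀) →+* ℂ, s.comp (im m₀) = τ ∧ (ρ : ℂ →+* ℂ).comp s ≠ s := by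
  set M : IntermediateField ℚ ℂ := normalClosure ℚ (Kf i₀) ℂ ⊔ ⨆ m : {m : Fin r // P m}, normalClosure ℚ (Kf (is m.1)) ℂ with hM
  haveI : Finite {m : Fin r // P m} := Subtype.finite
  haveI : FiniteDimensional ℚ M := IntermediateField.finiteDimensional_sup _ _
  obtain ⟨ρ, hρM, hρs⟩ := exists_ringEquiv_fix_comp_ne_of_apply_not_mem M s ha
  refine ⟨ρ, RingHom.ext fun x => hρM _ ?_, fun m hm u _ => RingHom.ext fun y => hρM _ ?_, s, hs, hρs⟩
  · exact le_sup_left (b := ⨆ m : {m : Fin r // P m}, normalClosure ℚ (Kf (is m.1)) ℂ) (ringHom_apply_mem_normalClosure τ x)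
  · refine le_sup_right (a := normalClosure ℚ (Kf i₀) ℂ) ?_
    exact le_iSup (fun m : {m : Fin r // P m} => normalClosure ℚ (Kf (is m.1)) ℂ) ⟨m, hm⟩ (ringHom_apply_mem_normalClosure u y)

/-! ## §2 `hJ` from the degree of ONE compositum -/

/-- **THE BINDER `hJ` FROM ONE DEGREE.**  `s₀` a family of `τ`-embeddings of the fields `K_m`, `P m`, and `n m` the number of `τ`-embeddings of `K_m`
(`= [K_m : k]`); if the subfield `ℚ(τ(k)) ⊔ ℚ(⋃_{P m} s₀_m(K_m))` of `ℂ` has degree `[k : ℚ] · ∏_{P m} n m` over `ℚ` — ONE compositum of full degree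
(linear disjointness over `k`) — then `Aut(ℂ)` is JOINTLY TRANSITIVE on the families of `τ`-embeddings of the `K_m`, `P m`: the shape of the hypothesis
`hJ` of `hodgeConjectureFor_biproduct_comp_of_sextics` ∕ `…_of_decics` (`P ≡ True`) and of `…_of_sexticsDecics` ∕ `…_of_jointPrimeTower_oneMember`
(`P m ≡ n m = n m₀`). [cite: Lang2002, VI §1 Thm. 1.1, Cor. 1.6 and V §2 Thm. 2.8] [cite: Shimura1998, §18.2 Lemma (i)] -/
theorem jointTransitive_of_finrank (im : ∀ m : Fin r, Kf i₀ →+* Kf (is m)) (P : Fin r → Prop) [DecidablePred P] (n : Fin r → ℕ)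
    (hn : ∀ m, P m → (Finset.univ.filter fun u : Kf (is m) →+* ℂ => u.comp (im m) = τ).card = n m)
    (s₀ : ∀ m : Fin r, Kf (is m) →+* ℂ) (hs₀ : ∀ m, P m → (s₀ m).comp (im m) = τ)
    (hdeg : Module.finrank ℚ ↥(adjoin ℚ (Set.range τ) ⊔ adjoin ℚ (⋃ (m : Fin r) (_ : P m), Set.range (s₀ m))) =
      Module.finrank ℚ (Kf i₀) * ∏ m ∈ Finset.univ.filter P, n m)
    (s s' : ∀ m : Fin r, Kf (is m) →+* ℂ) (hss' : ∀ m, P m → (s m).comp (im m) = τ ∧ (s' m).comp (im m) = τ) :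
    ∃ ρ : ℂ ≃+* ℂ, ∀ m, P m → (ρ : ℂ →+* ℂ).comp (s m) = s' m := by
  set M : IntermediateField ℚ ℂ := adjoin ℚ (Set.range τ) with hM
  haveI : FiniteDimensional ℚ M := Module.finite_of_finrank_pos (by rw [hM, finrank_adjoin_range_ringHom]; exact Module.finrank_pos)
  have hτM : ∀ x, τ x ∈ M := fun x => subset_adjoin ℚ _ ⟨x, rfl⟩
  -- the data restricted to the subtype `J = {m // P m}`
  have hU : (⋃ j : {m : Fin r // P m}, Set.range (s₀ j.1)) = ⋃ (m : Fin r) (_ : P m), Set.range (s₀ m) :=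
    Set.iUnion_subtype P fun j => Set.range (s₀ j.1)
  have hprod : ∏ j : {m : Fin r // P m}, n j.1 = ∏ m ∈ Finset.univ.filter P, n m :=
    (Finset.prod_subtype (Finset.univ.filter P) (fun m => by rw [Finset.mem_filter, and_iff_right (Finset.mem_univ m)]) n).symm
  have hdeg' : Module.finrank ℚ ↥(M ⊔ adjoin ℚ (⋃ j : {m : Fin r // P m}, Set.range (s₀ j.1))) =
      Module.finrank ℚ M * ∏ j : {m : Fin r // P m}, n j.1 := by
    rw [hU, hprod, hM, finrank_adjoin_range_ringHom, hdeg]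
  obtain ⟨ρ, -, hρ⟩ := exists_ringEquiv_fix_comp_eq_comp_of_finrank (K := fun j : {m : Fin r // P m} => Kf (is j.1)) (i := fun j => im j.1)
    M hτM (fun j => s₀ j.1) (fun j => hs₀ j.1 j.2) (fun j => n j.1) (fun j => hn j.1 j.2) hdeg' (fun j => s j.1) (fun j => s' j.1)
    (fun j => (hss' j.1 j.2).1) (fun j => (hss' j.1 j.2).2)
  exact ⟨ρ, fun m hm => hρ ⟨m, hm⟩⟩

/-! ## §3 `h2T` from ONE degree `n(n−1)` -/

/-- **THE BINDER `h2T` FROM ONE DEGREE `n(n−1)`.**  `L_P = L(k) ⊔ ⨆_{P m} L(K_m)` the compositum in `ℂ` of the Galois closures of `k` and of the fields to be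
fixed, `n` the number of `τ`-embeddings of `K_{m₀}`; if for ONE pair `s₀ ≠ t₀` of `τ`-embeddings of `K_{m₀}` the subfield `L_P ⊔ ℚ(s₀(K_{m₀}) ∪ t₀(K_{m₀}))`
has degree `[L_P : ℚ] · n(n−1)`, then any two pairs of distinct `τ`-embeddings of `K_{m₀}` are interchanged by an automorphism of `ℂ` FIXING every `τ`-embedding
of every `K_m`, `P m` — the shape of the hypothesis `h2T` of `hodgeConjectureFor_biproduct_comp_of_twoTransitiveTower_markman` (`P m ≡ m < m₀`) and of the
`2`-transitive branch of `…_mixedTower_markman` (`P m ≡ m ∈ L ∨ (m ∉ L ∧ m < m₀)`). [cite: Lang2002, VI §1 Thm. 1.1, Cor. 1.6 and V §2 Thm. 2.8]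
[cite: DixonMortimer1996, §1.6] -/
theorem twoTransitive_of_finrank (im : ∀ m : Fin r, Kf i₀ →+* Kf (is m)) (P : Fin r → Prop) (m₀ : Fin r) (n : ℕ)
    (hn : (Finset.univ.filter fun u : Kf (is m₀) →+* ℂ => u.comp (im m₀) = τ).card = n)
    {s₀ t₀ : Kf (is m₀) →+* ℂ} (hs₀ : s₀.comp (im m₀) = τ) (ht₀ : t₀.comp (im m₀) = τ) (hst₀ : s₀ ≠ t₀)
    (hdeg : Module.finrank ℚ ↥((normalClosure ℚ (Kf i₀) ℂ ⊔ ⨆ m : {m : Fin r // P m}, normalClosure ℚ (Kf (is m.1)) ℂ) ⊔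
        adjoin ℚ (Set.range s₀ ∪ Set.range t₀)) =
      Module.finrank ℚ ↥(normalClosure ℚ (Kf i₀) ℂ ⊔ ⨆ m : {m : Fin r // P m}, normalClosure ℚ (Kf (is m.1)) ℂ) * (n * (n - 1)))
    (s t s' t' : Kf (is m₀) →+* ℂ) (hs : s.comp (im m₀) = τ) (ht : t.comp (im m₀) = τ) (hs' : s'.comp (im m₀) = τ) (ht' : t'.comp (im m₀) = τ)
    (hst : s ≠ t) (hst' : s' ≠ t') :
    ∃ ρ : ℂ ≃+* ℂ, (∀ m, P m → ∀ u : Kf (is m) →+* ℂ, u.comp (im m) = τ → (ρ : ℂ →+* ℂ).comp u = u) ∧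
      (ρ : ℂ →+* ℂ).comp s = s' ∧ (ρ : ℂ →+* ℂ).comp t = t' := by
  set M : IntermediateField ℚ ℂ := normalClosure ℚ (Kf i₀) ℂ ⊔ ⨆ m : {m : Fin r // P m}, normalClosure ℚ (Kf (is m.1)) ℂ with hM
  haveI : Finite {m : Fin r // P m} := Subtype.finite
  haveI : FiniteDimensional ℚ M := IntermediateField.finiteDimensional_sup _ _
  have hτM : ∀ x, τ x ∈ M := fun x =>
    le_sup_left (b := ⨆ m : {m : Fin r // P m}, normalClosure ℚ (Kf (is m.1)) ℂ) (ringHom_apply_mem_normalClosure τ x)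
  obtain ⟨ρ, hρM, hρs, hρt⟩ := exists_ringEquiv_fix_pair_of_finrank M hτM hs₀ ht₀ hst₀ n hn hdeg s t s' t' hs ht hs' ht' hst hst'
  refine ⟨ρ, fun m hm u _ => RingHom.ext fun y => hρM _ ?_, hρs, hρt⟩
  refine le_sup_right (a := normalClosure ℚ (Kf i₀) ℂ) ?_
  exact le_iSup (fun m : {m : Fin r // P m} => normalClosure ℚ (Kf (is m.1)) ℂ) ⟨m, hm⟩ (ringHom_apply_mem_normalClosure u y)

end Engine

end Literature.NumberTheory.ComplexMultiplication.MultiFieldWeil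

end
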